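import Summits.QuantumFields.BalabanUV.Beta.D1BFx.TorusScalarCoarseWords
import Summits.QuantumFields.BalabanUV.Beta.D1BFx.KCombine

/-!
# `BalabanUV.Beta.D1BFx.TorusScalarCoarseSockets` — road «BF-x», binder row D1, slot (K), X₃(ii) ROUTE T, brick **K-TB3c PART 2, FILE 7** «COARSE-WORD
# SOCKETS» = (K4) «COARSE-2S̃−S» PART 1, second half: **the coarse `hessT` of the (R2) ghost side (`GhostHalfCovariantRoad` ∕ `TorusGhostSideHalf`) IS the
# socket `hessT` of `KCombine.hessKer_transfer_road(_family)` at EXPLICIT coarse arrays** — leg `(CsqK (m+1) a)^` on `Site 4 p × Unit`, first-order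
# families `arr p (−c•coW m a V•)` FIXED in `p`, second-order family `arr p (−c•coW m a Y + c•coW₂ m a s Vₛ Vₜ + c•coW₂ m a s Vₜ Vₛ)` `s`-INDEXED
# (`s = (m+1)·p`; FILE 6 gives its `s`-uniform bi-localisation and entrywise limit).

HONEST DEPENDENCY (cell records, verbatim): «continuum YM on T⁴ ⇐ BetaPertH ∧ nine spine estimates (0/9 proved); BetaPertH ⇐ (D1) ∧ (D4) ∧
CAP+tail; G-an2-4 gates asym, D1 and NE2/3/4.»  HONEST FRAMING (cell contract, verbatim): «discharging `BetaPertH` makes Bałaban's UV stability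
UNCONDITIONAL — a real constructive-QFT result; it is NOT the continuum limit and NOT the Clay problem.»  THIS MODULE DISCHARGES NOTHING of (K),
of D1 or of the wall: [folklore] re-indexing and linearity bookkeeping BY NAME over FILE 6 `TorusScalarCoarseWords` (`coW`, `coW₂`, `periodiseF_coW`,
`periodiseF_coW₂`, `arr_smul`, `perT_smul`, `submatrix_unit_mul'`, the `biLoc_*` letters), the owner's `KCombine.hessT_submatrix_unit`, leaf-03's `perT`∕`perT_add`∕
`perT_neg`∕`arr_neg`∕`summable_row_arr`, FILES 1–2 (`Qind`, `QindU`, `CsqHat`), PART 1 (`Ggh`, `CsqK`), the owner's `Ghat` and `MixedVarPackedHess.hessT`.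
No `def`, no `def … : Prop`, nothing cited, 0 sorry.  NOT D1, NOT BetaPertH, NOT continuum, NOT Clay.

ABSOLUTE RULE (cell charter, verbatim): «No internally-minted statement may enter as a cited fact. Every hypothesis is either kernel-proved in this
package or a verbatim quotation of a PUBLISHED theorem with page reference. The manuscript(s) under audit are NOT citable for their own disputed
steps — they are the thing under adjudication; programme-internal (2001/route/tribunal) claims are never citable.»

CONTENT (d = 4, `hs : s = (m+1)·p`; all [folklore]): `hessT_smul_leg` (`hessT (c•L) V V′ W = hessT L (c•V) (c•V′) (c•W)`); the definitional bridges
`Qind_eq_submatrix_QindU`, `Ghat_eq_perT`, `CsqHat_eq_perT`; `coarse_word₁` (`Qind·ĜĜ·perT s (arr s V)·ĜĜ·Qindᵀ = perT p (arr p (coW m a V))`),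
`coarse_word₂` (the wrapped two-array word `= perT p (arr p (coW₂ m a s X Y))`); the MAIN **`hessT_coarse_words_arr`**.
NOT HERE: (K4) PART 2 (the `n`-uniform bound `hCo`); the END's names `Sco`∕`ScoTil`; the uniform limit socket; the literal's fine words.
Provenance: NE9 formalisation swarm leaf seat `b2b-balaban-t4-ne9-formalise-leaf-02` gen 27 (cross-row prover duty NE9 → β∕D1 road «BF-x»; journal CLAIM
l.26220, SHAPE l.26459), 2026-08-21.
-/

noncomputable section

namespace Summit.QuantumFields.BalabanUV.Beta.D1BFx.TorusScalarCoarseSockets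

open Filter Topology Finset
open scoped BigOperators Matrix
open Literature.MathematicalPhysics.QuantumFieldTheory.Balaban1983to89
open Literature.MathematicalPhysics.QuantumFieldTheory.Balaban1983to89.Beta
open B6QGQLower276 (X blk)
open B6QGQDecay237 (deltaU)
open ExpKernelCalculus (Site MKer BiLoc)
open SecondOrderResponse (biLoc_smul biLoc_neg)
open Summit.QuantumFields.BalabanUV.Beta.D1BFx.FibredPeriodisation (periodiseF)
open Summit.QuantumFields.BalabanUV.Beta.D1BFx.PeriodicArrays (arr toF arr_apply summable_arr_term)
open Summit.QuantumFields.BalabanUV.Beta.D1BFx.MixedVarPackedHess (hessT)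
open Summit.QuantumFields.BalabanUV.Beta.D1BFx.GhostLeg (Ggh)
open Summit.QuantumFields.BalabanUV.Beta.D1BFx.TorusGhostGram (CsqK)
open Summit.QuantumFields.BalabanUV.Beta.D1BFx.PeriodisedProjector (Ghat)
open Summit.QuantumFields.BalabanUV.Beta.D1BFx.TorusScalarAveraging (Qind)
open Summit.QuantumFields.BalabanUV.Beta.D1BFx.TorusScalarCoarseGram (CsqHat QindU)
open Summit.QuantumFields.BalabanUV.Beta.D1BFx.TorusGhostWordArrays (perT perT_add summable_row_arr)
open Summit.QuantumFields.BalabanUV.Beta.D1BFx.TorusGhostPairStencils (perT_neg arr_neg)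
open Summit.QuantumFields.BalabanUV.Beta.D1BFx.TorusScalarCoarseWords
open Summit.QuantumFields.BalabanUV.Beta.D1BFx.KCombine (hessT_submatrix_unit)

/-! ## The coarse `hessT` of the (R2) ghost side in the socket currency of `KCombine` -/

section Sockets

variable {m : ℕ} {a : ℝ} {s p : ℕ} [NeZero s] [NeZero p]

/-- [folklore] **`hessT` MOVES A SCALAR FROM THE LEG TO THE THREE JETS**: `hessT (c•L) V V′ W = hessT L (c•V) (c•V′) (c•W)` (the tadpole is linear,
the bubble quadratic in the leg AND bilinear in the first-order jets). -/
theorem hessT_smul_leg {ι : Type*} [Fintype ι] (c : ℝ) (L V V' W : Matrix ι ι ℝ) :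
    hessT (c • L) V V' W = hessT L (c • V) (c • V') (c • W) := by
  unfold hessT
  simp only [Matrix.smul_mul, Matrix.mul_smul, Matrix.trace_smul, smul_eq_mul]

omit [NeZero p] in
/-- [folklore] **BRIDGE, BLOCK INDICATOR**: FILE 1's `Qind m s p` is FILE 2's `QindU (m+1) s p` read back through the `Unit` re-indexing (definitional). -/
theorem Qind_eq_submatrix_QindU : Qind m s p = (QindU (m + 1) s p).submatrix (fun x => (x, ())) (fun y => (y, ())) := by
  ext x y; rfl

omit [NeZero p] in
/-- [folklore] **BRIDGE, TOWER LEG**: the owner's `Ghat m a s` is `perT s (Ggh (m+1) a)` (definitional; `TorusGhostLegs.Ghat_eq_submatrix_periodiseF`). -/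
theorem Ghat_eq_perT : Ghat m a s = perT s (Ggh (m + 1) a) := by
  ext x y; rfl

omit [NeZero s] in
/-- [folklore] **BRIDGE, COARSE LEG**: FILE 2's `CsqHat m a p` is `perT p (CsqK (m+1) a)` (definitional). -/
theorem CsqHat_eq_perT : CsqHat m a p = perT p (CsqK (m + 1) a) := by
  ext x y; rfl

variable {V Xk Yk Vs Vt Yk' : MKer 4 Unit} {P Q P' Q' Ps Qs Pt Qt PY QY : X 4} {C C' Cs Ct CY δ : ℝ}

/-- [folklore] **THE FIRST-ORDER COARSE WORD IN THE OWNER'S UNFIBRED LETTERS**: `Qind·(ĜĜ)·perT s (arr s V)·(ĜĜ)·Qindᵀ = perT p (arr p (coW m a V))`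
(FILE 6 `periodiseF_coW` pulled through the `Unit` re-indexing). -/
theorem coarse_word₁ (ha : 0 < a) (hs : s = (m + 1) * p) (hV : BiLoc V P Q C δ) (hδ : 0 < δ) :
    Qind m s p * (Ghat m a s * Ghat m a s) * perT s (arr s V) * (Ghat m a s * Ghat m a s) * (Qind m s p)ᵀ = perT p (arr p (coW m a V)) := by
  rw [Qind_eq_submatrix_QindU, Ghat_eq_perT, Matrix.transpose_submatrix]
  simp only [perT, submatrix_unit_mul']
  rw [show QindU (m + 1) s p * (Matrix.of (periodiseF s (toF (Ggh (m + 1) a))) * Matrix.of (periodiseF s (toF (Ggh (m + 1) a))))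
      * Matrix.of (periodiseF s (toF (arr s V))) * (Matrix.of (periodiseF s (toF (Ggh (m + 1) a))) * Matrix.of (periodiseF s (toF (Ggh (m + 1) a))))
      * (QindU (m + 1) s p)ᵀ
      = QindU (m + 1) s p * (Matrix.of (periodiseF s (toF (Ggh (m + 1) a))) * Matrix.of (periodiseF s (toF (Ggh (m + 1) a)))
      * Matrix.of (periodiseF s (toF (arr s V))) * (Matrix.of (periodiseF s (toF (Ggh (m + 1) a))) * Matrix.of (periodiseF s (toF (Ggh (m + 1) a)))))
      * (QindU (m + 1) s p)ᵀ by simp only [Matrix.mul_assoc], periodiseF_coW ha hs hV hδ]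

/-- [folklore] **THE WRAPPED TWO-ARRAY COARSE WORD IN THE OWNER'S UNFIBRED LETTERS**:
`Qind·(ĜĜ)·perT s (arr s X)·(ĜĜ)·perT s (arr s Y)·(ĜĜ)·Qindᵀ = perT p (arr p (coW₂ m a s X Y))` (FILE 6 `periodiseF_coW₂` re-indexed). -/
theorem coarse_word₂ (ha : 0 < a) (hs : s = (m + 1) * p) (hX : BiLoc Xk P Q C δ) (hY : BiLoc Yk P' Q' C' δ) (hδ : 0 < δ) :
    Qind m s p * (Ghat m a s * Ghat m a s) * perT s (arr s Xk) * (Ghat m a s * Ghat m a s) * perT s (arr s Yk) * (Ghat m a s * Ghat m a s)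
        * (Qind m s p)ᵀ
      = perT p (arr p (coW₂ m a s Xk Yk)) := by
  rw [Qind_eq_submatrix_QindU, Ghat_eq_perT, Matrix.transpose_submatrix]
  simp only [perT, submatrix_unit_mul']
  rw [show QindU (m + 1) s p * (Matrix.of (periodiseF s (toF (Ggh (m + 1) a))) * Matrix.of (periodiseF s (toF (Ggh (m + 1) a))))
      * Matrix.of (periodiseF s (toF (arr s Xk))) * (Matrix.of (periodiseF s (toF (Ggh (m + 1) a))) * Matrix.of (periodiseF s (toF (Ggh (m + 1) a))))
      * Matrix.of (periodiseF s (toF (arr s Yk))) * (Matrix.of (periodiseF s (toF (Ggh (m + 1) a))) * Matrix.of (periodiseF s (toF (Ggh (m + 1) a))))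
      * (QindU (m + 1) s p)ᵀ
      = QindU (m + 1) s p * (Matrix.of (periodiseF s (toF (Ggh (m + 1) a))) * Matrix.of (periodiseF s (toF (Ggh (m + 1) a)))
      * Matrix.of (periodiseF s (toF (arr s Xk))) * (Matrix.of (periodiseF s (toF (Ggh (m + 1) a))) * Matrix.of (periodiseF s (toF (Ggh (m + 1) a))))
      * Matrix.of (periodiseF s (toF (arr s Yk))) * (Matrix.of (periodiseF s (toF (Ggh (m + 1) a))) * Matrix.of (periodiseF s (toF (Ggh (m + 1) a)))))
      * (QindU (m + 1) s p)ᵀ by simp only [Matrix.mul_assoc], periodiseF_coW₂ ha hs hX hY hδ]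

/-- [folklore] **(K4) PART 1 — THE COARSE `hessT` OF THE (R2) GHOST SIDE IS THE SOCKET `hessT` OF EXPLICIT COARSE ARRAYS.**  For `0 < a`, `s = (m+1)·p`,
fine words given as ARRAYS `Xs = perT s (arr s Vs)`, `Xt = perT s (arr s Vt)`, `Yst = perT s (arr s Y)` of bi-localised `ℤ⁴` stencils at a common rate, and any
leg scalar `c` (`c = ((m+1)^4)⁻¹` in `GhostHalfCovariantRoad.hessT_ghost_halfCovariant_torus`):
`hessT (c•Ĉsq) (−Q·ĜĜ·Xs·ĜĜ·Qᵀ) (−Q·ĜĜ·Xt·ĜĜ·Qᵀ) (−Q·ĜĜ·Yst·ĜĜ·Qᵀ + Q·ĜĜ·Xs·ĜĜ·Xt·ĜĜ·Qᵀ + Q·ĜĜ·Xt·ĜĜ·Xs·ĜĜ·Qᵀ)`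
`= hessT ((CsqK (m+1) a)^) ((arr p (−c•coW Vs))^) ((arr p (−c•coW Vt))^) ((arr p (−c•coW Y + c•coW₂ s Vs Vt + c•coW₂ s Vt Vs))^)`
— LITERALLY the coarse 4-tuple of `KCombine.hessKer_transfer_road(_family)`'s `hId` (leg `(CsqK (m+1) a)^` on `Site 4 p × Unit`), the first-order families
FIXED in `p`, the second-order family `s`-INDEXED (FILE 6 §2: bi-localised uniformly in `s`, entrywise convergent to the `coW₂lim` word). -/
theorem hessT_coarse_words_arr (ha : 0 < a) (hs : s = (m + 1) * p) (hVs : BiLoc Vs Ps Qs Cs δ) (hVt : BiLoc Vt Pt Qt Ct δ)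
    (hY : BiLoc Yk' PY QY CY δ) (hδ : 0 < δ) (c : ℝ) (Xs Xt Yst : Matrix (Site 4 s) (Site 4 s) ℝ)
    (hXs : Xs = perT s (arr s Vs)) (hXt : Xt = perT s (arr s Vt)) (hYst : Yst = perT s (arr s Yk')) :
    hessT (c • CsqHat m a p)
        (-(Qind m s p * (Ghat m a s * Ghat m a s) * Xs * (Ghat m a s * Ghat m a s) * (Qind m s p)ᵀ))
        (-(Qind m s p * (Ghat m a s * Ghat m a s) * Xt * (Ghat m a s * Ghat m a s) * (Qind m s p)ᵀ))
        (-(Qind m s p * (Ghat m a s * Ghat m a s) * Yst * (Ghat m a s * Ghat m a s) * (Qind m s p)ᵀ)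
          + Qind m s p * (Ghat m a s * Ghat m a s) * Xs * (Ghat m a s * Ghat m a s) * Xt * (Ghat m a s * Ghat m a s) * (Qind m s p)ᵀ
          + Qind m s p * (Ghat m a s * Ghat m a s) * Xt * (Ghat m a s * Ghat m a s) * Xs * (Ghat m a s * Ghat m a s) * (Qind m s p)ᵀ)
      = hessT (Matrix.of (periodiseF p (toF (CsqK (m + 1) a))))
          (Matrix.of (periodiseF p (toF (arr p (-(c • coW m a Vs))))))
          (Matrix.of (periodiseF p (toF (arr p (-(c • coW m a Vt))))))
          (Matrix.of (periodiseF p (toF (arr p (-(c • coW m a Yk') + c • coW₂ m a s Vs Vt + c • coW₂ m a s Vt Vs))))) := by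
  subst hXs hXt hYst
  -- bi-localisation letters of the three coarse families at period `p`
  have hr0 := rate_pos (m := m) ha hδ
  have hr4 : 0 < min (deltaU 4 a / (4 * ((m + 1 : ℕ) : ℝ)) / 2) δ / 4 / 4 := by positivity
  obtain ⟨CY', hbY⟩ := biLoc_coW (m := m) ha hY hδ
  obtain ⟨C₂, hb₂⟩ := biLoc_coW₂ (m := m) ha hVs hVt hδ
  obtain ⟨C₃, hb₃⟩ := biLoc_coW₂ (m := m) ha hVt hVs hδ
  have hbY' : BiLoc (-(c • coW m a Yk')) (blk m PY) (blk m QY) (|c| * CY') (min (deltaU 4 a / (4 * ((m + 1 : ℕ) : ℝ)) / 2) δ / 4) :=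
    biLoc_neg (biLoc_smul c hbY)
  have hb₂' : BiLoc (c • coW₂ m a s Vs Vt) (blk m Ps) (blk m Qs) (|c| * C₂) (min (deltaU 4 a / (4 * ((m + 1 : ℕ) : ℝ)) / 2) δ / 4 / 4) :=
    biLoc_smul c (hb₂ s)
  have hb₃' : BiLoc (c • coW₂ m a s Vt Vs) (blk m Pt) (blk m Qt) (|c| * C₃) (min (deltaU 4 a / (4 * ((m + 1 : ℕ) : ℝ)) / 2) δ / 4 / 4) :=
    biLoc_smul c (hb₃ s)
  have hrowY := summable_row_arr p hbY' hr0
  have hrow₂ := summable_row_arr p hb₂' hr4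
  have hrow₃ := summable_row_arr p hb₃' hr4
  -- the words as periodised coarse arrays, the scalar moved into the arrays, the sums merged, the `Unit` re-indexing removed
  rw [coarse_word₁ ha hs hVs hδ, coarse_word₁ ha hs hVt hδ, coarse_word₁ ha hs hY hδ, coarse_word₂ ha hs hVs hVt hδ, coarse_word₂ ha hs hVt hVs hδ,
    CsqHat_eq_perT, hessT_smul_leg]
  simp only [smul_add, smul_neg, ← perT_smul, ← arr_smul, ← perT_neg, ← arr_neg]
  -- merge the three periodised arrays of the second-order slot into one
  have hrow₁₂ : ∀ x, Summable fun y => (arr p (-(c • coW m a Yk')) + arr p (c • coW₂ m a s Vs Vt)) x y () () :=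
    fun x => (hrowY x).add (hrow₂ x)
  have h1 := fun x y (u v : Unit) => summable_arr_term hbY' hr0 p x y u v
  have h2 := fun x y (u v : Unit) => summable_arr_term hb₂' hr4 p x y u v
  have h3 := fun x y (u v : Unit) => summable_arr_term hb₃' hr4 p x y u v
  have harr : arr p (-(c • coW m a Yk') + c • coW₂ m a s Vs Vt + c • coW₂ m a s Vt Vs)
      = arr p (-(c • coW m a Yk')) + arr p (c • coW₂ m a s Vs Vt) + arr p (c • coW₂ m a s Vt Vs) := by
    funext x y u v
    simp only [arr_apply, Pi.add_apply]
    rw [((h1 x y u v).add (h2 x y u v)).tsum_add (h3 x y u v), (h1 x y u v).tsum_add (h2 x y u v)]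
  rw [← perT_add p hrowY hrow₂, ← perT_add p hrow₁₂ hrow₃, ← harr]
  exact hessT_submatrix_unit _ _ _ _

end Sockets

end Summit.QuantumFields.BalabanUV.Beta.D1BFx.TorusScalarCoarseSockets

end
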